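import Literature.Analysis.FluidPDE.OnsagerBDSVDeformationBounds
import Literature.Analysis.FluidPDE.OnsagerBDSVTransportHigher
import Literature.Analysis.FluidPDE.OnsagerBDSVPerturbationFlowBounds
import Literature.Analysis.FluidPDE.OnsagerBDSVFlowJacobian
import Literature.Analysis.FluidPDE.OnsagerBDSVAntidivCurl
import HarnessLib

/-!
# The BDSV perturbation: proof of the deformation bound (Prop. 5.7, arXiv (5.23))

Buckmaster–De Lellis–Székelyhidi–Vicol (BDSV), *Onsager's conjecture for admissible weak
solutions*, CPAM 72 (2019) = arXiv:1701.08678, Prop. 5.7, first item (arXiv (5.23)):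
for `t ∈ Ĩ_i` and `N ≥ 0`, `‖(∇Φ_i)⁻¹‖_N + ‖∇Φ_i‖_N ≲ ℓ^{-N}`. The printed proof: "From (2.19),
(B.5) and (B.6) we obtain `‖∇Φ_i‖_N ≲ 1 + τ_q ‖Dv̄_q‖_N ≲ 1 + τ_q δ_q^{1/2} λ_q ℓ^{-N}`. Using the
fact that `‖∇Φ_i - Id‖₀ ≤ 1/2`, the estimate (5.23) follows."

This file PROVES the named fact `BDSV.gradPhiBound` of `OnsagerBDSVDeformationBounds.lean`
(`BDSV.gradPhiBound_holds`) along these lines, for the honest objects of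
`OnsagerBDSVPerturbation.lean`:

* `BDSV.displacement_allOrders` — App. B (B.6) at all orders for a transported displacement:
  if `(∂ₜ + v·∇)D = -v` on `[a,b] × T^d`, `D(t₀, ·) = 0`, `‖v(s)‖_{j+1} ≤ Λ M^j` (`j ≤ N`,
  `M ≥ 1`) and `(b - a) Λ K_N ≤ 1`, then `‖D(s)‖_{n+1} ≤ K_N (b-a) Λ M^n` for `n ≤ N`
  (induction on `N` over the level-`N` transport estimate
  `BDSV.eContDiffHolderNorm_transport_higher` with `α = 0`);
* the bookkeeping from `D_i` to the matrix fields `∇Φ_i = Id + ∇D_i` and `(∇Φ_i)⁻¹`: entries,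
  the elementwise sup norm, `det ∇Φ_i = 1` (`BDSV.PerturbationData.det_gradPhi_eq_one`, so that
  `(∇Φ_i)⁻¹ = adj ∇Φ_i` is quadratic in the entries) and the Leibniz estimate
  `Torus.eContDiffHolderNorm_bilinear_le`;
* the parameter step: on `Ĩ_i ⊆ [max(0, t_i - τ_q/3), min(T, t_{i+1} + τ_q/3)]`, an interval of
  length `≤ 5τ_q/3` containing the anchor `min(t_i, T)`, the smallness
  `(5/3) K_N C_in τ_q δ_q^{1/2} λ_q = (5/3) K_N C_in ℓ^{2α} ≤ 1` holds for `a ≥ a₀`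
  (`BDSV.exists_threshold_mollScale_rpow_le`), whence `‖∇Φ_i‖_N, ‖(∇Φ_i)⁻¹‖_N ≤ 72 (N+1) 3^N ℓ^{-N}`.

## References

* T. Buckmaster, C. De Lellis, L. Székelyhidi Jr., V. Vicol, *Onsager's conjecture for admissible
  weak solutions*, Comm. Pure Appl. Math. 72 (2019) 229–274 = arXiv:1701.08678, §5.5 Prop. 5.7
  (arXiv (5.23)) and its proof; App. B Prop. B.1 (B.5)–(B.6); §2.5 (2.16), (2.19); Lemma 5.4.
-/

open MeasureTheory Set
open scoped NNReal ENNReal ContDiff Matrix Matrix.Norms.Elementwise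

noncomputable section

namespace Literature.Analysis.FluidPDE

namespace BDSV

open FunctionSpaces FunctionSpaces.Torus

/-! ## Generic Hölder-norm lemmas -/

section Generic

variable {d : Type} [Fintype d] {Y : Type} [NormedAddCommGroup Y] [NormedSpace ℝ Y]

/-- The `C^{k,r}` norm of a constant function on the torus is at most the norm of the constant
(all derivatives of positive order vanish, and the Hölder seminorm of a constant is zero). [folklore] -/
theorem eContDiffHolderNorm_const_le (k : ℕ) (r : ℝ≥0) (c : Y) :
    Torus.eContDiffHolderNorm k r (fun _ : UnitAddTorus d => c) ≤ ‖c‖ₑ := by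
  change FunctionSpaces.eContDiffHolderNorm k r (fun _ : EuclideanSpace ℝ d => c) ≤ ‖c‖ₑ
  unfold FunctionSpaces.eContDiffHolderNorm
  have hj : ∀ j, j ≠ 0 → iteratedFDeriv ℝ j (fun _ : EuclideanSpace ℝ d => c) = 0 := fun j hj =>
    iteratedFDeriv_const_of_ne hj c
  have hzero : ∀ j ∈ Finset.range k,
      eSupNorm (iteratedFDeriv ℝ (j + 1) (fun _ : EuclideanSpace ℝ d => c)) = 0 := by
    intro j _
    rw [hj (j + 1) (Nat.succ_ne_zero j)]
    exact eSupNorm_zero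
  have hH : eHolderNorm r (iteratedFDeriv ℝ k (fun _ : EuclideanSpace ℝ d => c)) = 0 := by
    cases k with
    | zero =>
      have e : iteratedFDeriv ℝ 0 (fun _ : EuclideanSpace ℝ d => c) =
          Function.const _ (iteratedFDeriv ℝ 0 (fun _ : EuclideanSpace ℝ d => c) 0) := by
        funext y
        ext m
        simp
      rw [e]
      exact eHolderNorm_const _ r _
    | succ k =>
      rw [hj (k + 1) (Nat.succ_ne_zero k)]
      exact eHolderNorm_zero _ r
  rw [Finset.sum_range_succ', Finset.sum_eq_zero hzero, zero_add, hH, add_zero,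
    eSupNorm_iteratedFDeriv_zero]
  exact iSup_le fun _ => le_rfl

/-- A `C^{1,r}` bound `‖w‖_{1,r} ≤ W` (`0 ≤ W`) bounds the derivative pointwise: `‖Dw(x)‖ ≤ W`.
[folklore] -/
theorem norm_torusFderiv_le_of_one_le {w : UnitAddTorus d → Y} {r : ℝ≥0} {W : ℝ} (hW : 0 ≤ W)
    (h : Torus.eContDiffHolderNorm 1 r w ≤ ENNReal.ofReal W) (x : UnitAddTorus d) :
    ‖Torus.fderiv w x‖ ≤ W := by
  have h1 : ‖Torus.fderiv w x‖ₑ ≤ ENNReal.ofReal W :=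
    (enorm_le_eSupNorm _ x).trans ((Torus.eSupNorm_le_eContDiffHolderNorm 0 r _).trans
      ((Torus.eContDiffHolderNorm_fderiv_le 0 r w).trans h))
  rw [← ofReal_norm] at h1
  exact (ENNReal.ofReal_le_ofReal_iff hW).1 h1

end Generic

/-! ## App. B (B.6) at all orders for a transported displacement -/

section Displacement

variable {d : Type} [Fintype d] [DecidableEq d]

/-- **All-orders deformation bound for a transported displacement** (BDSV App. B, Prop. B.1
(B.5)–(B.6): "`‖∇Φ(t) - Id‖₀ ≲ |t|[v]₁`, `[Φ(t)]_N ≲ |t|[v]_N ∀ N ≥ 2`" under `|t|‖v‖₁ ≤ 1`, for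
the inverse flux `Φ = id + D`). For every `N` there is `K ≥ 2` such that: if `v, D` are jointly
smooth on `[a,b] × T^d`, `∂ₜD + (v·∇)D = -v`, `D(t₀, ·) = 0` for some `t₀ ∈ [a,b]`,
`‖v(s)‖_{j+1,0} ≤ Λ M^j` for `s ∈ [a,b]`, `j ≤ N` (`Λ ≥ 0`, `M ≥ 1`) and `(b - a) Λ K ≤ 1`, then
`‖D(s)‖_{n+1,0} ≤ K (b - a) Λ M^n` for all `s ∈ [a,b]` and `n ≤ N`.
[cite: BuckmasterEtAl2018, App. B Prop. B.1 (B.5)–(B.6)] -/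
theorem displacement_allOrders (N : ℕ) :
    ∃ K : ℝ, 2 ≤ K ∧ ∀ {a b : ℝ} (_ : a < b)
      {v : ℝ → UnitAddTorus d → EuclideanSpace ℝ d} (_ : IsSmoothSpaceTimeOn (Icc a b) v)
      {D : ℝ → UnitAddTorus d → EuclideanSpace ℝ d} (_ : IsSmoothSpaceTimeOn (Icc a b) D)
      (_ : ∀ s ∈ Icc a b, ∀ x, timeDerivWithin (Icc a b) D s x + convect (v s) (D s) x = -v s x)
      {t₀ : ℝ} (_ : t₀ ∈ Icc a b) (_ : ∀ x, D t₀ x = 0) {Λ M : ℝ} (_ : 0 ≤ Λ) (_ : 1 ≤ M)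
      (_ : ∀ s ∈ Icc a b, ∀ j ≤ N,
        Torus.eContDiffHolderNorm (j + 1) 0 (v s) ≤ ENNReal.ofReal (Λ * M ^ j))
      (_ : (b - a) * Λ * K ≤ 1),
      ∀ s ∈ Icc a b, ∀ n ≤ N,
        Torus.eContDiffHolderNorm (n + 1) 0 (D s) ≤ ENNReal.ofReal (K * ((b - a) * Λ) * M ^ n) := by
  induction N with
  | zero =>
    obtain ⟨A, hA1, hT⟩ := eContDiffHolderNorm_transport_higher (d := d) (F := EuclideanSpace ℝ d) 1
    refine ⟨max 2 A, le_max_left _ _, ?_⟩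
    intro a b hab v hv D hD heq t₀ ht₀ h0 Λ M hΛ hM hvb hsmall s hs n hn
    obtain rfl : n = 0 := Nat.le_zero.1 hn
    have hL : 0 < b - a := sub_pos.2 hab
    have hK2 : (2 : ℝ) ≤ max 2 A := le_max_left _ _
    have hKA : A ≤ max 2 A := le_max_right _ _
    have hK0 : 0 ≤ max 2 A := zero_le_two.trans hK2
    have hLΛ : (b - a) * Λ ≤ 1 / 2 := by
      have h1 : (b - a) * Λ * 2 ≤ (b - a) * Λ * max 2 A :=
        mul_le_mul_of_nonneg_left hK2 (mul_nonneg hL.le hΛ)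
      linarith
    -- data for the level-`1` transport estimate
    have hone : ∀ s ∈ Icc a b, Torus.eContDiffHolderNorm 1 0 (v s) ≤ ENNReal.ofReal Λ := by
      intro s hs
      have h := hvb s hs 0 le_rfl
      rwa [pow_zero, mul_one] at h
    have hKf : ∀ s ∈ Icc a b, ∀ x, ‖Torus.fderiv (v s) x‖ ≤ (⟨Λ, hΛ⟩ : ℝ≥0) :=
      fun s hs x => norm_torusFderiv_le_of_one_le hΛ (hone s hs) x
    have hKL : ((⟨Λ, hΛ⟩ : ℝ≥0) : ℝ) * (b - a) ≤ 1 / 2 := by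
      change Λ * (b - a) ≤ 1 / 2
      linarith [mul_comm Λ (b - a)]
    set V : ℕ → ℝ := fun _ => Λ with hVdef
    have hV0 : ∀ j, 0 ≤ V j := fun _ => hΛ
    have hV : ∀ s ∈ Icc a b, ∀ j, 1 ≤ j → j ≤ 1 →
        Torus.eContDiffHolderNorm j 0 (v s) ≤ ENNReal.ofReal (V j) := by
      intro s hs j hj hj1
      obtain rfl : j = 1 := le_antisymm hj1 hj
      exact hone s hs
    have hsm : (b - a) * V 1 * A ≤ 1 := by
      calc (b - a) * V 1 * A = (b - a) * Λ * A := rfl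
        _ ≤ (b - a) * Λ * max 2 A := mul_le_mul_of_nonneg_left hKA (mul_nonneg hL.le hΛ)
        _ ≤ 1 := hsmall
    have hG : IsSmoothSpaceTimeOn (Icc a b) (fun s x => -v s x) := hv.neg
    have hΦ : ∀ s ∈ Icc a b, ∀ m, 1 ≤ m → m < 1 →
        Torus.eContDiffHolderNorm m 0 (D s) ≤ ENNReal.ofReal ((fun _ : ℕ => (0 : ℝ)) m) := by
      intro s hs m hm hm1
      omega
    have hD0 : D t₀ = 0 := funext h0
    have hF₀ : Torus.eContDiffHolderNorm 1 0 (D t₀) ≤ ENNReal.ofReal 0 := by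
      rw [hD0, Torus.eContDiffHolderNorm_zero_fun]
      exact bot_le
    have hGb : ∀ s ∈ Icc a b, Torus.eContDiffHolderNorm 1 0 (fun x => -v s x) ≤ ENNReal.ofReal Λ := by
      intro s hs
      have e : (fun x => -v s x) = -(v s) := rfl
      rw [e, Torus.eContDiffHolderNorm_neg]
      exact hone s hs
    have h := hT hab zero_le_one hv hKf hKL hV0 ht₀ hV hsm hD hG heq (Φ := fun _ => 0)
      (fun _ => le_rfl) hΦ le_rfl hΛ hF₀ hGb s hs
    refine h.trans (ENNReal.ofReal_le_ofReal ?_)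
    simp only [Nat.sub_self, Finset.range_zero, Finset.sum_empty, mul_zero, add_zero, zero_add,
      pow_zero, mul_one]
    calc A * ((b - a) * Λ) ≤ max 2 A * ((b - a) * Λ) :=
          mul_le_mul_of_nonneg_right hKA (mul_nonneg hL.le hΛ)
      _ = _ := by ring
  | succ N IH =>
    obtain ⟨K, hK2, hIH⟩ := IH
    obtain ⟨A, hA1, hT⟩ := eContDiffHolderNorm_transport_higher (d := d) (F := EuclideanSpace ℝ d) (N + 2)
    have hK0 : 0 ≤ K := zero_le_two.trans hK2
    have hK1 : 1 ≤ K := one_le_two.trans hK2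
    have hA0 : 0 ≤ A := zero_le_one.trans hA1
    -- the new constant
    set K' : ℝ := max K (A * (1 + (N + 1) * K)) with hK'def
    have hKK' : K ≤ K' := le_max_left _ _
    have hbig : 1 ≤ 1 + ((N : ℝ) + 1) * K := by
      have : 0 ≤ ((N : ℝ) + 1) * K := by positivity
      linarith
    have hAK' : A ≤ K' := le_trans (le_mul_of_one_le_right hA0 hbig) (le_max_right _ _)
    have hK'0 : 0 ≤ K' := hK0.trans hKK'
    refine ⟨K', hK2.trans hKK', ?_⟩
    intro a b hab v hv D hD heq t₀ ht₀ h0 Λ M hΛ hM hvb hsmall s hs n hn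
    have hL : 0 < b - a := sub_pos.2 hab
    set L := b - a with hLdef
    have hM0 : 0 ≤ M := zero_le_one.trans hM
    have hM1 : ∀ k : ℕ, 1 ≤ M ^ k := fun k => one_le_pow₀ hM
    have hLΛ0 : 0 ≤ L * Λ := mul_nonneg hL.le hΛ
    -- smallness consequences
    have hsmallK : L * Λ * K ≤ 1 := (mul_le_mul_of_nonneg_left hKK' hLΛ0).trans hsmall
    have hsmallA : L * Λ * A ≤ 1 := (mul_le_mul_of_nonneg_left hAK' hLΛ0).trans hsmall
    have hLΛ1 : L * Λ ≤ 1 := by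
      have h1 : L * Λ * 1 ≤ L * Λ * K := mul_le_mul_of_nonneg_left hK1 hLΛ0
      linarith
    have hLΛ : L * Λ ≤ 1 / 2 := by
      have h1 : L * Λ * 2 ≤ L * Λ * K := mul_le_mul_of_nonneg_left hK2 hLΛ0
      linarith
    -- the lower levels from the induction hypothesis
    have hlow : ∀ s ∈ Icc a b, ∀ m ≤ N,
        Torus.eContDiffHolderNorm (m + 1) 0 (D s) ≤ ENNReal.ofReal (K * (L * Λ) * M ^ m) :=
      hIH hab hv hD heq ht₀ h0 hΛ hM (fun s hs j hj => hvb s hs j (hj.trans (Nat.le_succ N)))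
        hsmallK
    -- the case `n ≤ N` is the induction hypothesis
    rcases Nat.lt_or_ge n (N + 1) with hnN | hnN
    · refine (hlow s hs n (Nat.lt_succ_iff.1 hnN)).trans (ENNReal.ofReal_le_ofReal ?_)
      exact mul_le_mul_of_nonneg_right (mul_le_mul_of_nonneg_right hKK' hLΛ0) (zero_le_one.trans (hM1 n))
    obtain rfl : n = N + 1 := le_antisymm hn hnN
    -- the top level `N + 2` by the transport estimate
    have hone : ∀ s ∈ Icc a b, Torus.eContDiffHolderNorm 1 0 (v s) ≤ ENNReal.ofReal Λ := by
      intro s hs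
      have h := hvb s hs 0 (Nat.zero_le _)
      rwa [pow_zero, mul_one] at h
    have hKf : ∀ s ∈ Icc a b, ∀ x, ‖Torus.fderiv (v s) x‖ ≤ (⟨Λ, hΛ⟩ : ℝ≥0) :=
      fun s hs x => norm_torusFderiv_le_of_one_le hΛ (hone s hs) x
    have hKL : ((⟨Λ, hΛ⟩ : ℝ≥0) : ℝ) * (b - a) ≤ 1 / 2 := by
      change Λ * L ≤ 1 / 2
      linarith [mul_comm Λ L]
    set V : ℕ → ℝ := fun j => Λ * M ^ (j - 1) with hVdef
    have hV0 : ∀ j, 0 ≤ V j := fun j => mul_nonneg hΛ (zero_le_one.trans (hM1 _))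
    have hV : ∀ s ∈ Icc a b, ∀ j, 1 ≤ j → j ≤ N + 2 →
        Torus.eContDiffHolderNorm j 0 (v s) ≤ ENNReal.ofReal (V j) := by
      intro s hs j hj hjN
      obtain ⟨i, rfl⟩ : ∃ i, j = i + 1 := ⟨j - 1, by omega⟩
      have h := hvb s hs i (by omega)
      simpa [hVdef] using h
    have hsm : (b - a) * V 1 * A ≤ 1 := by
      have e : V 1 = Λ := by simp [hVdef]
      rw [e]
      exact hsmallA
    have hG : IsSmoothSpaceTimeOn (Icc a b) (fun s x => -v s x) := hv.neg
    set Φ : ℕ → ℝ := fun m => K * (L * Λ) * M ^ (m - 1) with hΦdef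
    have hΦ0 : ∀ m, 0 ≤ Φ m := fun m =>
      mul_nonneg (mul_nonneg hK0 hLΛ0) (zero_le_one.trans (hM1 _))
    have hΦ : ∀ s ∈ Icc a b, ∀ m, 1 ≤ m → m < N + 2 →
        Torus.eContDiffHolderNorm m 0 (D s) ≤ ENNReal.ofReal (Φ m) := by
      intro s hs m hm hmN
      obtain ⟨i, rfl⟩ : ∃ i, m = i + 1 := ⟨m - 1, by omega⟩
      have h := hlow s hs i (by omega)
      simpa [hΦdef] using h
    have hD0 : D t₀ = 0 := funext h0
    have hF₀ : Torus.eContDiffHolderNorm (N + 2) 0 (D t₀) ≤ ENNReal.ofReal 0 := by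
      rw [hD0, Torus.eContDiffHolderNorm_zero_fun]
      exact bot_le
    have hG₀0 : 0 ≤ Λ * M ^ (N + 1) := mul_nonneg hΛ (zero_le_one.trans (hM1 _))
    have hGb : ∀ s ∈ Icc a b, Torus.eContDiffHolderNorm (N + 2) 0 (fun x => -v s x) ≤
        ENNReal.ofReal (Λ * M ^ (N + 1)) := by
      intro s hs
      have e : (fun x => -v s x) = -(v s) := rfl
      rw [e, Torus.eContDiffHolderNorm_neg]
      exact hvb s hs (N + 1) le_rfl
    have h := hT hab zero_le_one hv hKf hKL hV0 ht₀ hV hsm hD hG heq hΦ0 hΦ le_rfl hG₀0 hF₀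
      hGb s hs
    refine h.trans (ENNReal.ofReal_le_ofReal ?_)
    -- the lower-order sum
    have hsum : ∑ i ∈ Finset.range (N + 2 - 1), V (i + 2) * Φ (N + 2 - 1 - i) ≤
        ((N : ℝ) + 1) * K * (Λ * M ^ (N + 1)) := by
      have hterm : ∀ i ∈ Finset.range (N + 2 - 1), V (i + 2) * Φ (N + 2 - 1 - i) ≤
          K * (Λ * M ^ (N + 1)) := by
        intro i hi
        have hiN : i < N + 1 := by simpa using Finset.mem_range.1 hi
        have hpow : M ^ (i + 2 - 1) * M ^ (N + 2 - 1 - i - 1) = M ^ (N + 1) := by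
          rw [← pow_add]; congr 1; omega
        calc V (i + 2) * Φ (N + 2 - 1 - i)
            = K * (L * Λ) * (Λ * (M ^ (i + 2 - 1) * M ^ (N + 2 - 1 - i - 1))) := by
              simp only [hVdef, hΦdef]; ring
          _ = K * (L * Λ) * (Λ * M ^ (N + 1)) := by rw [hpow]
          _ ≤ K * 1 * (Λ * M ^ (N + 1)) :=
              mul_le_mul_of_nonneg_right (mul_le_mul_of_nonneg_left hLΛ1 hK0) hG₀0
          _ = K * (Λ * M ^ (N + 1)) := by ring
      calc ∑ i ∈ Finset.range (N + 2 - 1), V (i + 2) * Φ (N + 2 - 1 - i)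
          ≤ ∑ _i ∈ Finset.range (N + 2 - 1), K * (Λ * M ^ (N + 1)) := Finset.sum_le_sum hterm
        _ = ((N : ℝ) + 1) * K * (Λ * M ^ (N + 1)) := by
            rw [Finset.sum_const, Finset.card_range, nsmul_eq_mul]
            have e : ((N + 2 - 1 : ℕ) : ℝ) = (N : ℝ) + 1 := by
              rw [show N + 2 - 1 = N + 1 by omega]; push_cast; ring
            rw [e]; ring
    calc A * (0 + (b - a) * (Λ * M ^ (N + 1)) +
          (b - a) * ∑ i ∈ Finset.range (N + 2 - 1), V (i + 2) * Φ (N + 2 - 1 - i))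
        ≤ A * (0 + L * (Λ * M ^ (N + 1)) + L * (((N : ℝ) + 1) * K * (Λ * M ^ (N + 1)))) := by
          refine mul_le_mul_of_nonneg_left (add_le_add le_rfl ?_) hA0
          exact mul_le_mul_of_nonneg_left hsum hL.le
      _ = (A * (1 + (N + 1) * K)) * (L * Λ) * M ^ (N + 1) := by ring
      _ ≤ K' * (L * Λ) * M ^ (N + 1) := by
          refine mul_le_mul_of_nonneg_right (mul_le_mul_of_nonneg_right (le_max_right _ _) hLΛ0) ?_
          exact zero_le_one.trans (hM1 _)

end Displacement

/-! ## Matrix fields: entries, products, the adjugate -/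

section MatrixFields

variable {d : Type} [Fintype d]

/-- The `C^{N,r}` norm of a matrix field (elementwise sup norm) is at most the sum of the norms
of its entries. [folklore] -/
theorem eContDiffHolderNorm_matrix_le_sum {N : ℕ} {F : UnitAddTorus d → Matrix (Fin 3) (Fin 3) ℝ} (hF : IsContDiff N F)
    (r : ℝ≥0) :
    Torus.eContDiffHolderNorm N r F ≤ ∑ a, ∑ b, Torus.eContDiffHolderNorm N r (fun x => F x a b) := by
  have h1 : Torus.eContDiffHolderNorm N r F ≤ ∑ a, Torus.eContDiffHolderNorm N r (fun x => F x a) :=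
    Torus.eContDiffHolderNorm_pi_le_sum (Φ := fun _ : Fin 3 => Fin 3 → ℝ) hF r
  refine h1.trans (Finset.sum_le_sum fun a _ => ?_)
  have hFa : IsContDiff N (fun x => F x a) :=
    (ContinuousLinearMap.proj (R := ℝ) (φ := fun _ : Fin 3 => Fin 3 → ℝ) a).contDiff.comp hF
  exact Torus.eContDiffHolderNorm_pi_le_sum (Φ := fun _ : Fin 3 => ℝ) hFa r

/-- **Products of real functions in `C^{N,r}`**: `‖fg‖_{N,r} ≤ 3ᴺ ∑_{j ≤ N} ‖f‖_{j,r} ‖g‖_{N-j,r}`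
(the Leibniz estimate for the multiplication pairing, of norm `≤ 1`). [folklore] -/
theorem eContDiffHolderNorm_mul_le_sum {N : ℕ} {f g : UnitAddTorus d → ℝ} (hf : IsContDiff N f)
    (hg : IsContDiff N g) (r : ℝ≥0) :
    Torus.eContDiffHolderNorm N r (fun x => f x * g x) ≤
      3 ^ N * ∑ j ∈ Finset.range (N + 1),
        Torus.eContDiffHolderNorm j r f * Torus.eContDiffHolderNorm (N - j) r g := by
  have h := Torus.eContDiffHolderNorm_bilinear_le (ContinuousLinearMap.mul ℝ ℝ) hf hg r
  simp only [ContinuousLinearMap.mul_apply'] at h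
  refine h.trans ?_
  have h1 : ‖(ContinuousLinearMap.mul ℝ ℝ)‖ₑ ≤ 1 := by
    rw [← ofReal_norm, ← ENNReal.ofReal_one]
    exact ENNReal.ofReal_le_ofReal (ContinuousLinearMap.opNorm_mul_le ℝ ℝ)
  calc 3 ^ N * ‖ContinuousLinearMap.mul ℝ ℝ‖ₑ * ∑ j ∈ Finset.range (N + 1),
        Torus.eContDiffHolderNorm j r f * Torus.eContDiffHolderNorm (N - j) r g
      ≤ 3 ^ N * 1 * ∑ j ∈ Finset.range (N + 1),
        Torus.eContDiffHolderNorm j r f * Torus.eContDiffHolderNorm (N - j) r g := by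
        gcongr
    _ = _ := by rw [mul_one]

/-- A product of two real functions with level-wise bounds `‖f‖_{j,r}, ‖g‖_{j,r} ≤ E_j` (`j ≤ N`)
has `‖fg‖_{N,r} ≤ 3ᴺ ∑_{j ≤ N} E_j E_{N-j}`. [folklore] -/
theorem eContDiffHolderNorm_mul_le_of_levels {N : ℕ} {f g : UnitAddTorus d → ℝ} (hf : IsContDiff N f)
    (hg : IsContDiff N g) (r : ℝ≥0) {E : ℕ → ℝ} (hE0 : ∀ j, 0 ≤ E j)
    (hfE : ∀ j ≤ N, Torus.eContDiffHolderNorm j r f ≤ ENNReal.ofReal (E j))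
    (hgE : ∀ j ≤ N, Torus.eContDiffHolderNorm j r g ≤ ENNReal.ofReal (E j)) :
    Torus.eContDiffHolderNorm N r (fun x => f x * g x) ≤
      ENNReal.ofReal (3 ^ N * ∑ j ∈ Finset.range (N + 1), E j * E (N - j)) := by
  refine (eContDiffHolderNorm_mul_le_sum hf hg r).trans ?_
  rw [ENNReal.ofReal_mul (by positivity), ENNReal.ofReal_pow (by norm_num), ENNReal.ofReal_ofNat,
    ENNReal.ofReal_sum_of_nonneg fun j _ => mul_nonneg (hE0 _) (hE0 _)]
  refine mul_le_mul' le_rfl (Finset.sum_le_sum fun j hj => ?_)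
  have hjN : j ≤ N := Nat.lt_succ_iff.1 (Finset.mem_range.1 hj)
  rw [ENNReal.ofReal_mul (hE0 _)]
  exact mul_le_mul' (hfE j hjN) (hgE (N - j) (Nat.sub_le N j))

/-- The entries of the adjugate of a `3 × 3` matrix are differences of two products of two
entries, with an index pattern depending only on the position (`Matrix.adjugate_fin_three`). [folklore] -/
theorem adjugate_fin_three_entry (i j : Fin 3) :
    ∃ p q u w p' q' u' w' : Fin 3, ∀ A : Matrix (Fin 3) (Fin 3) ℝ, A.adjugate i j = A p q * A u w - A p' q' * A u' w' := by
  fin_cases i <;> fin_cases j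
  · exact ⟨1, 1, 2, 2, 1, 2, 2, 1, fun A => by rw [Matrix.adjugate_fin_three]; simp⟩
  · exact ⟨0, 2, 2, 1, 0, 1, 2, 2, fun A => by rw [Matrix.adjugate_fin_three]; simp; ring⟩
  · exact ⟨0, 1, 1, 2, 0, 2, 1, 1, fun A => by rw [Matrix.adjugate_fin_three]; simp⟩
  · exact ⟨1, 2, 2, 0, 1, 0, 2, 2, fun A => by rw [Matrix.adjugate_fin_three]; simp; ring⟩
  · exact ⟨0, 0, 2, 2, 0, 2, 2, 0, fun A => by rw [Matrix.adjugate_fin_three]; simp⟩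
  · exact ⟨0, 2, 1, 0, 0, 0, 1, 2, fun A => by rw [Matrix.adjugate_fin_three]; simp; ring⟩
  · exact ⟨1, 0, 2, 1, 1, 1, 2, 0, fun A => by rw [Matrix.adjugate_fin_three]; simp⟩
  · exact ⟨0, 1, 2, 0, 0, 0, 2, 1, fun A => by rw [Matrix.adjugate_fin_three]; simp; ring⟩
  · exact ⟨0, 0, 1, 1, 0, 1, 1, 0, fun A => by rw [Matrix.adjugate_fin_three]; simp⟩

/-- **The adjugate of a matrix field in `C^{N,r}`**: if all entries of `A(·)` are `C^N` with
`‖A(·)_{ab}‖_{j,r} ≤ E_j` for `j ≤ N`, then every entry of `adj A(·)` has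
`‖(adj A(·))_{ij}‖_{N,r} ≤ 2 · 3ᴺ ∑_{j ≤ N} E_j E_{N-j}`. [folklore] -/
theorem eContDiffHolderNorm_adjugate_entry_le {N : ℕ} {A : UnitAddTorus d → Matrix (Fin 3) (Fin 3) ℝ}
    (hA : ∀ a b, IsContDiff N (fun x => A x a b)) (r : ℝ≥0) {E : ℕ → ℝ} (hE0 : ∀ j, 0 ≤ E j)
    (hAE : ∀ j ≤ N, ∀ a b, Torus.eContDiffHolderNorm j r (fun x => A x a b) ≤ ENNReal.ofReal (E j))
    (i j : Fin 3) :
    Torus.eContDiffHolderNorm N r (fun x => (A x).adjugate i j) ≤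
      ENNReal.ofReal (2 * (3 ^ N * ∑ j ∈ Finset.range (N + 1), E j * E (N - j))) := by
  obtain ⟨p, q, u, w, p', q', u', w', hrep⟩ := adjugate_fin_three_entry i j
  have e : (fun x => (A x).adjugate i j) =
      (fun x => A x p q * A x u w) - fun x => A x p' q' * A x u' w' := by
    funext x
    simp only [Pi.sub_apply, hrep]
  rw [e]
  have h1 : IsContDiff N (fun x => A x p q * A x u w) := (hA p q).mul (hA u w)
  have h2 : IsContDiff N (fun x => A x p' q' * A x u' w') := (hA p' q').mul (hA u' w')
  refine (Torus.eContDiffHolderNorm_sub_le h1 h2).trans ?_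
  have hS : 0 ≤ 3 ^ N * ∑ j ∈ Finset.range (N + 1), E j * E (N - j) :=
    mul_nonneg (by positivity) (Finset.sum_nonneg fun j _ => mul_nonneg (hE0 _) (hE0 _))
  rw [two_mul, ENNReal.ofReal_add hS hS]
  exact add_le_add
    (eContDiffHolderNorm_mul_le_of_levels (hA p q) (hA u w) r hE0 (fun j hj => hAE j hj p q)
      (fun j hj => hAE j hj u w))
    (eContDiffHolderNorm_mul_le_of_levels (hA p' q') (hA u' w') r hE0 (fun j hj => hAE j hj p' q')
      (fun j hj => hAE j hj u' w'))

variable [DecidableEq d]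

/-- **An entry of `∇Φ = Id + ∇D` in `C^{N,r}`**: for smooth `g : T^d → ℝ^d`, `a b : d` and a
constant `c`, `‖c + ∂_b g_a‖_{N,r} ≤ |c| + ‖g‖_{N+1,r}`. [folklore] -/
theorem eContDiffHolderNorm_const_add_partialDeriv_le {g : UnitAddTorus d → EuclideanSpace ℝ d}
    (hg : IsSmooth g) (c : ℝ) (a b : d) (N : ℕ) (r : ℝ≥0) :
    Torus.eContDiffHolderNorm N r (fun x => c + partialDeriv b g x a) ≤
      ‖c‖ₑ + Torus.eContDiffHolderNorm (N + 1) r g := by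
  have hpd : IsSmooth (partialDeriv b g) := hg.partialDeriv b
  have hc : IsContDiff N (fun _ : UnitAddTorus d => c) := isContDiff_const c
  have hpa : IsContDiff N (fun x => partialDeriv b g x a) :=
    (hpd.apply a).isContDiff (by exact_mod_cast le_top)
  have e : (fun x => c + partialDeriv b g x a) =
      (fun _ : UnitAddTorus d => c) + fun x => partialDeriv b g x a := rfl
  rw [e]
  refine (Torus.eContDiffHolderNorm_add_le hc hpa).trans (add_le_add ?_ ?_)
  · exact eContDiffHolderNorm_const_le N r c
  · exact (eContDiffHolderNorm_coord_le hpd N r a).trans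
      (Torus.eContDiffHolderNorm_partialDeriv_le (hg.isContDiff (by exact_mod_cast le_top)) b r)

/-- The entries of `∇Φ_i = BDSV.gradPhi D i t`: `(∇Φ_i)_{ab} = δ_{ab} + ∂_b (D_i)_a`. [folklore] -/
theorem gradPhi_apply (D : ℕ → ℝ → UnitAddTorus (Fin 3) → EuclideanSpace ℝ (Fin 3)) (i : ℕ)
    (t : ℝ) (x : UnitAddTorus (Fin 3)) (a b : Fin 3) :
    gradPhi D i t x a b = (1 : Matrix (Fin 3) (Fin 3) ℝ) a b + partialDeriv b (D i t) x a := by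
  simp only [gradPhi, Matrix.add_apply, Matrix.of_apply]

/-- The entries of `∇Φ_i(t)` are smooth in space for a smooth slice `D_i(t)`. [folklore] -/
theorem isSmooth_gradPhi_entry {D : ℕ → ℝ → UnitAddTorus (Fin 3) → EuclideanSpace ℝ (Fin 3)}
    {i : ℕ} {t : ℝ} (hD : IsSmooth (D i t)) (a b : Fin 3) :
    IsSmooth (fun x => gradPhi D i t x a b) := by
  have e : (fun x => gradPhi D i t x a b) = fun x => (1 : Matrix (Fin 3) (Fin 3) ℝ) a b + partialDeriv b (D i t) x a := by
    funext x; exact gradPhi_apply D i t x a b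
  rw [e]
  exact (isSmooth_const _).add ((hD.partialDeriv b).apply a)

/-- The matrix field `∇Φ_i(t)` is `C^N` in space (elementwise sup norm) for a smooth slice
`D_i(t)`. [folklore] -/
theorem isContDiff_gradPhi {D : ℕ → ℝ → UnitAddTorus (Fin 3) → EuclideanSpace ℝ (Fin 3)}
    {i : ℕ} {t : ℝ} (hD : IsSmooth (D i t)) (N : ℕ) :
    IsContDiff N (fun x => gradPhi D i t x) := by
  refine contDiff_pi.2 fun a => contDiff_pi.2 fun b => ?_
  exact (isSmooth_gradPhi_entry hD a b).isContDiff (by exact_mod_cast le_top)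

/-- **`∇Φ_i` in `C^{N,r}` from `D_i` in `C^{N+1,r}`**: `‖∇Φ_i(t)‖_{N,r} ≤ 9 (1 + ‖D_i(t)‖_{N+1,r})`.
[cite: BuckmasterEtAl2018, Prop. 5.7 (arXiv (5.23)), proof] -/
theorem eContDiffHolderNorm_gradPhi_le {D : ℕ → ℝ → UnitAddTorus (Fin 3) → EuclideanSpace ℝ (Fin 3)}
    {i : ℕ} {t : ℝ} (hD : IsSmooth (D i t)) (N : ℕ) (r : ℝ≥0) :
    Torus.eContDiffHolderNorm N r (fun x => gradPhi D i t x) ≤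
      9 * (1 + Torus.eContDiffHolderNorm (N + 1) r (D i t)) := by
  refine (eContDiffHolderNorm_matrix_le_sum (isContDiff_gradPhi hD N) r).trans ?_
  have hentry : ∀ a b : Fin 3, Torus.eContDiffHolderNorm N r (fun x => gradPhi D i t x a b) ≤
      1 + Torus.eContDiffHolderNorm (N + 1) r (D i t) := by
    intro a b
    have e : (fun x => gradPhi D i t x a b) = fun x => (1 : Matrix (Fin 3) (Fin 3) ℝ) a b + partialDeriv b (D i t) x a := by
      funext x; exact gradPhi_apply D i t x a b
    rw [e]
    refine (eContDiffHolderNorm_const_add_partialDeriv_le hD _ a b N r).trans (add_le_add ?_ le_rfl)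
    rw [← ofReal_norm, ← ENNReal.ofReal_one]
    refine ENNReal.ofReal_le_ofReal ?_
    rw [Matrix.one_apply]
    split_ifs <;> simp
  calc ∑ a, ∑ b, Torus.eContDiffHolderNorm N r (fun x => gradPhi D i t x a b)
      ≤ ∑ _a : Fin 3, ∑ _b : Fin 3, (1 + Torus.eContDiffHolderNorm (N + 1) r (D i t)) :=
        Finset.sum_le_sum fun a _ => Finset.sum_le_sum fun b _ => hentry a b
    _ = 9 * (1 + Torus.eContDiffHolderNorm (N + 1) r (D i t)) := by
        rw [Finset.sum_const, Finset.sum_const, Finset.card_univ, Fintype.card_fin, nsmul_eq_mul,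
          nsmul_eq_mul]
        push_cast
        ring

/-- **`adj ∇Φ_i` in `C^{N,r}` from level-wise bounds on `D_i`**: if `‖D_i(t)‖_{j+1,r} ≤ B_j` for
`j ≤ N` then `‖adj ∇Φ_i(t)‖_{N,r} ≤ 18 · 3ᴺ ∑_{j ≤ N} (1 + B_j)(1 + B_{N-j})`.
[cite: BuckmasterEtAl2018, Prop. 5.7 (arXiv (5.23)), proof] -/
theorem eContDiffHolderNorm_adjugate_gradPhi_le {D : ℕ → ℝ → UnitAddTorus (Fin 3) → EuclideanSpace ℝ (Fin 3)}
    {i : ℕ} {t : ℝ} (hD : IsSmooth (D i t)) (N : ℕ) (r : ℝ≥0) {B : ℕ → ℝ} (hB0 : ∀ j, 0 ≤ B j)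
    (hB : ∀ j ≤ N, Torus.eContDiffHolderNorm (j + 1) r (D i t) ≤ ENNReal.ofReal (B j)) :
    Torus.eContDiffHolderNorm N r (fun x => (gradPhi D i t x).adjugate) ≤
      ENNReal.ofReal (18 * (3 ^ N * ∑ j ∈ Finset.range (N + 1), (1 + B j) * (1 + B (N - j)))) := by
  have hA : ∀ a b, IsContDiff N (fun x => gradPhi D i t x a b) := fun a b =>
    (isSmooth_gradPhi_entry hD a b).isContDiff (by exact_mod_cast le_top)
  have hAE : ∀ j ≤ N, ∀ a b, Torus.eContDiffHolderNorm j r (fun x => gradPhi D i t x a b) ≤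
      ENNReal.ofReal (1 + B j) := by
    intro j hj a b
    have e : (fun x => gradPhi D i t x a b) = fun x => (1 : Matrix (Fin 3) (Fin 3) ℝ) a b + partialDeriv b (D i t) x a := by
      funext x; exact gradPhi_apply D i t x a b
    rw [e, ENNReal.ofReal_add zero_le_one (hB0 j), ENNReal.ofReal_one]
    refine (eContDiffHolderNorm_const_add_partialDeriv_le hD _ a b j r).trans (add_le_add ?_ (hB j hj))
    rw [← ofReal_norm, ← ENNReal.ofReal_one]
    refine ENNReal.ofReal_le_ofReal ?_
    rw [Matrix.one_apply]
    split_ifs <;> simp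
  have hadj : IsContDiff N (fun x => (gradPhi D i t x).adjugate) := by
    refine contDiff_pi.2 fun a => contDiff_pi.2 fun b => ?_
    obtain ⟨p, q, u, w, p', q', u', w', hrep⟩ := adjugate_fin_three_entry a b
    have e : (fun x => lift (fun x => (gradPhi D i t x).adjugate) x a b) =
        lift ((fun x => gradPhi D i t x p q * gradPhi D i t x u w) -
          fun x => gradPhi D i t x p' q' * gradPhi D i t x u' w') := by
      funext y
      simp only [lift, Function.comp_apply, Pi.sub_apply, hrep]
    rw [e]
    exact ((hA p q).mul (hA u w)).sub ((hA p' q').mul (hA u' w'))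
  refine (eContDiffHolderNorm_matrix_le_sum hadj r).trans ?_
  have hE0 : ∀ j, 0 ≤ 1 + B j := fun j => add_nonneg zero_le_one (hB0 j)
  have hS : 0 ≤ 3 ^ N * ∑ j ∈ Finset.range (N + 1), (1 + B j) * (1 + B (N - j)) :=
    mul_nonneg (by positivity) (Finset.sum_nonneg fun j _ => mul_nonneg (hE0 _) (hE0 _))
  calc ∑ a, ∑ b, Torus.eContDiffHolderNorm N r (fun x => (gradPhi D i t x).adjugate a b)
      ≤ ∑ _a : Fin 3, ∑ _b : Fin 3,
          ENNReal.ofReal (2 * (3 ^ N * ∑ j ∈ Finset.range (N + 1), (1 + B j) * (1 + B (N - j)))) :=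
        Finset.sum_le_sum fun a _ => Finset.sum_le_sum fun b _ =>
          eContDiffHolderNorm_adjugate_entry_le hA r hE0 hAE a b
    _ = ENNReal.ofReal (18 * (3 ^ N * ∑ j ∈ Finset.range (N + 1), (1 + B j) * (1 + B (N - j)))) := by
        rw [Finset.sum_const, Finset.sum_const, Finset.card_univ, Fintype.card_fin, nsmul_eq_mul,
          nsmul_eq_mul, ← ENNReal.ofReal_natCast 3, ← ENNReal.ofReal_mul (by norm_num),
          ← ENNReal.ofReal_mul (by norm_num)]
        congr 1
        push_cast
        ring

end MatrixFields

/-! ## Proof of Prop. 5.7, first item (arXiv (5.23)) -/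

section Assembly

/-- `ℓ ≤ 1` for `a, b ≥ 1`, `β, α ≥ 0` (from (2.11) `ℓ ≤ λ_q⁻¹`). [cite: BuckmasterEtAl2018, §2.4 (2.11)] -/
theorem mollScale_le_one_of_params {β α a b : ℝ} (ha : 1 ≤ a) (hb : 1 ≤ b) (hβ : 0 ≤ β) (hα : 0 ≤ α)
    (q : ℕ) : mollScale β α a b q ≤ 1 :=
  (mollScale_le_freq_inv ha hb hβ hα q).trans (inv_le_one_of_one_le₀ (one_le_freq ha q))

/-- **The deformation bound holds** (BDSV Prop. 5.7, first item, arXiv (5.23): for `t ∈ Ĩ_i`,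
`‖(∇Φ_i)⁻¹‖_N + ‖∇Φ_i‖_N ≲ ℓ^{-N}`). Proof as printed: the all-orders transport bound (B.6) for
the displacement `Φ_i - id` on the interval `Ĩ_i` (length `≤ 5τ_q/3` around the anchor), fed with
(2.19) and the smallness `τ_q δ_q^{1/2} λ_q = ℓ^{2α} → 0` (`a` large), gives
`‖∇Φ_i - Id‖_{N} ≤ ℓ^{-N}`; the inverse is the adjugate (`det ∇Φ_i = 1`), quadratic in the
entries, and is estimated by the Leibniz rule. The constant is `C = 72 (N+1) 3ᴺ`, with `α₀ = 1`,
`N̄ = N`. [cite: BuckmasterEtAl2018, Prop. 5.7 (arXiv (5.23))] -/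
theorem gradPhiBound_holds : gradPhiBound := by
  intro c₀ _hc₀ Cη β hβ _hβ3 b hb1 _hb2
  refine ⟨1, one_pos, ?_⟩
  intro α hα _hα1 N
  obtain ⟨K, hK2, hK⟩ := displacement_allOrders (d := Fin 3) N
  refine ⟨N, ?_⟩
  intro Cin C₀
  obtain ⟨a₀, ha₀1, ha₀⟩ :=
    exists_threshold_mollScale_rpow_le hβ.le hb1.le hα (5 / 3 * K * |Cin|) one_pos
  refine ⟨72 * ((N : ℝ) + 1) * 3 ^ N, a₀, ha₀1, ?_⟩
  intro a ha S H 𝒟 i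
  -- parameters
  have ha1 : 1 ≤ a := ha₀1.le.trans ha
  have hK0 : 0 ≤ K := zero_le_two.trans hK2
  have hℓ : 0 < mollScale β α a b S.q := mollScale_pos ha1 _
  have hℓ1 : mollScale β α a b S.q ≤ 1 := mollScale_le_one_of_params ha1 hb1.le hβ.le hα.le S.q
  have hτ : 0 < Params.τ ⟨β, α, a, b⟩ S.q := glueScale_pos ha1 _
  have hT : 0 < S.T := H.pos_T
  set ℓ := mollScale β α a b S.q with hℓdef
  set τ := Params.τ ⟨β, α, a, b⟩ S.q with hτdef
  set M := ℓ⁻¹ with hMdef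
  have hM1 : 1 ≤ M := (one_le_inv₀ hℓ).2 hℓ1
  have hM0 : 0 ≤ M := zero_le_one.trans hM1
  have hMpow : ∀ n : ℕ, ℓ ^ (-(n : ℝ)) = M ^ n := fun n => by
    rw [Real.rpow_neg hℓ.le, Real.rpow_natCast, hMdef, inv_pow]
  have hMk : ∀ k : ℕ, 1 ≤ M ^ k := fun k => one_le_pow₀ hM1
  set Λ := |Cin| * (Real.sqrt (amp β a b S.q) * freq a b S.q) with hΛdef
  have hX0 : 0 ≤ Real.sqrt (amp β a b S.q) * freq a b S.q :=
    mul_nonneg (Real.sqrt_nonneg _) (freq_pos ha1 _).le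
  have hΛ0 : 0 ≤ Λ := mul_nonneg (abs_nonneg _) hX0
  -- `Λ τ_q = |C_in| ℓ^{2α}` and the smallness for `a ≥ a₀`
  have hΛτ : Λ * τ = |Cin| * ℓ ^ (2 * α) :=
    velocityBound_mul_tau (P := ⟨β, α, a, b⟩) (Cin := |Cin|) ha1 S.q
  have hsmall0 : 5 / 3 * K * |Cin| * ℓ ^ (2 * α) ≤ 1 := ha₀ a ha S.q
  -- (2.19) in the form `‖v̄_q(s)‖_{j+1} ≤ Λ M^j`
  have hvb : ∀ s ∈ Icc 0 S.T, ∀ j ≤ N,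
      Torus.eContDiffHolderNorm (j + 1) 0 (S.vbar s) ≤ ENNReal.ofReal (Λ * M ^ j) := by
    intro s hs j hj
    refine (H.velocity j hj s hs).trans (ENNReal.ofReal_le_ofReal ?_)
    change Cin * (Real.sqrt (amp β a b S.q) * freq a b S.q * ℓ ^ (-(j : ℝ))) ≤ Λ * M ^ j
    rw [hMpow j, hΛdef]
    calc Cin * (Real.sqrt (amp β a b S.q) * freq a b S.q * M ^ j)
        ≤ |Cin| * (Real.sqrt (amp β a b S.q) * freq a b S.q * M ^ j) :=
          mul_le_mul_of_nonneg_right (le_abs_self Cin) (mul_nonneg hX0 (zero_le_one.trans (hMk j)))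
      _ = _ := by ring
  -- the transport equation of `D_i` on `[0,T]`
  have heq0 : ∀ s ∈ Icc 0 S.T, ∀ x, timeDerivWithin (Icc 0 S.T) (𝒟.D i) s x +
      convect (S.vbar s) (𝒟.D i s) x = -S.vbar s x :=
    fun s hs x => eq_neg_of_add_eq_zero_left ((𝒟.flow i).transport s hs x)
  have hDsm : IsSmoothSpaceTimeOn (Icc 0 S.T) (𝒟.D i) := (𝒟.flow i).smooth
  have hvsm : IsSmoothSpaceTimeOn (Icc 0 S.T) S.vbar := H.eulerReynolds.smooth_velocity
  -- the final constant dominates the two intermediate ones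
  have hC1 : (1 : ℝ) ≤ ((N : ℝ) + 1) * 3 ^ N := by
    have h3 : (1 : ℝ) ≤ 3 ^ N := one_le_pow₀ (by norm_num)
    have hN : (0 : ℝ) ≤ N := Nat.cast_nonneg N
    nlinarith
  -- the bounds for `t ∈ Ĩ_i`
  have key : ∀ t ∈ tildeInterval S.T τ i,
      Torus.eContDiffHolderNorm N 0 (fun x => gradPhi 𝒟.D i t x) ≤
          ENNReal.ofReal (72 * ((N : ℝ) + 1) * 3 ^ N * ℓ ^ (-(N : ℝ))) ∧
        Torus.eContDiffHolderNorm N 0 (fun x => (gradPhi 𝒟.D i t x)⁻¹) ≤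
          ENNReal.ofReal (72 * ((N : ℝ) + 1) * 3 ^ N * ℓ ^ (-(N : ℝ))) := by
    intro t ht
    obtain ⟨ht0, ht1⟩ := ht
    -- the interval `[a', b'] ⊇ Ĩ_i`
    set a' := max 0 ((i : ℝ) * τ - τ / 3) with ha'def
    set b' := min S.T (((i : ℝ) + 1) * τ + τ / 3) with hb'def
    have hi0 : 0 ≤ (i : ℝ) * τ := mul_nonneg i.cast_nonneg hτ.le
    have hab' : a' < b' := by
      refine max_lt (lt_min hT (by linarith [ht1.2, ht0.1])) (lt_min (by linarith [ht1.1, ht0.2]) ?_)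
      nlinarith
    have hsub : Icc a' b' ⊆ Icc 0 S.T := fun s hs =>
      ⟨(le_max_left _ _).trans hs.1, hs.2.trans (min_le_left _ _)⟩
    have ht' : t ∈ Icc a' b' := ⟨max_le ht0.1 ht1.1.le, le_min ht0.2 ht1.2.le⟩
    have ht₀ : min ((i : ℝ) * τ) S.T ∈ Icc a' b' := by
      refine ⟨max_le (le_min hi0 hT.le) (le_min (by linarith) (by linarith [ht1.1, ht0.2])),
        le_min (min_le_right _ _) ((min_le_left _ _).trans (by nlinarith))⟩
    have hlen : b' - a' ≤ 5 / 3 * τ := by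
      have h1 : b' ≤ ((i : ℝ) + 1) * τ + τ / 3 := min_le_right _ _
      have h2 : (i : ℝ) * τ - τ / 3 ≤ a' := le_max_right _ _
      nlinarith
    have hL0 : 0 ≤ b' - a' := (sub_pos.2 hab').le
    -- smallness on `[a', b']`
    have hsmall : (b' - a') * Λ * K ≤ 1 := by
      calc (b' - a') * Λ * K ≤ (5 / 3 * τ) * Λ * K :=
            mul_le_mul_of_nonneg_right (mul_le_mul_of_nonneg_right hlen hΛ0) hK0
        _ = 5 / 3 * K * (Λ * τ) := by ring
        _ = 5 / 3 * K * |Cin| * ℓ ^ (2 * α) := by rw [hΛτ]; ring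
        _ ≤ 1 := hsmall0
    have hKLΛ : K * ((b' - a') * Λ) ≤ 1 := by
      calc K * ((b' - a') * Λ) = (b' - a') * Λ * K := by ring
        _ ≤ 1 := hsmall
    -- the all-orders bound for `D_i` on `[a', b']`
    have heq' := transport_restrict hab' hsub hDsm heq0
    have hDb : ∀ n ≤ N, Torus.eContDiffHolderNorm (n + 1) 0 (𝒟.D i t) ≤ ENNReal.ofReal (M ^ n) := by
      intro n hn
      have h := hK hab' (hvsm.mono hsub) (hDsm.mono hsub) heq' ht₀ (𝒟.flow i).anchor hΛ0 hM1
        (fun s hs j hj => hvb s (hsub hs) j hj) hsmall t ht' n hn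
      refine h.trans (ENNReal.ofReal_le_ofReal ?_)
      calc K * ((b' - a') * Λ) * M ^ n ≤ 1 * M ^ n :=
            mul_le_mul_of_nonneg_right hKLΛ (zero_le_one.trans (hMk n))
        _ = M ^ n := one_mul _
    have hDt : IsSmooth (𝒟.D i t) := hDsm.isSmooth_slice ht0
    have hfinal : 0 ≤ 72 * ((N : ℝ) + 1) * 3 ^ N * M ^ N := by positivity
    constructor
    · -- `‖∇Φ_i(t)‖_N ≤ 9 (1 + M^N) ≤ 72 (N+1) 3^N M^N`
      refine (eContDiffHolderNorm_gradPhi_le hDt N 0).trans ?_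
      rw [hMpow N]
      calc (9 : ℝ≥0∞) * (1 + Torus.eContDiffHolderNorm (N + 1) 0 (𝒟.D i t))
          ≤ 9 * (1 + ENNReal.ofReal (M ^ N)) := by gcongr; exact hDb N le_rfl
        _ = ENNReal.ofReal (9 * (1 + M ^ N)) := by
            rw [ENNReal.ofReal_mul (by norm_num), ENNReal.ofReal_ofNat,
              ENNReal.ofReal_add zero_le_one (zero_le_one.trans (hMk N)), ENNReal.ofReal_one]
        _ ≤ ENNReal.ofReal (72 * ((N : ℝ) + 1) * 3 ^ N * M ^ N) := by
            refine ENNReal.ofReal_le_ofReal ?_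
            have h1 : 9 * (1 + M ^ N) ≤ 18 * M ^ N := by linarith [hMk N]
            have h2 : 18 * M ^ N ≤ 72 * (((N : ℝ) + 1) * 3 ^ N) * M ^ N := by
              have := hMk N
              nlinarith
            linarith
    · -- `(∇Φ_i)⁻¹ = adj ∇Φ_i` since `det ∇Φ_i = 1`
      have hinv : (fun x => (gradPhi 𝒟.D i t x)⁻¹) = fun x => (gradPhi 𝒟.D i t x).adjugate := by
        funext x
        rw [Matrix.inv_def, 𝒟.det_gradPhi_eq_one H ha1 i ht0 x, Ring.inverse_one, one_smul]
      rw [hinv, hMpow N]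
      refine (eContDiffHolderNorm_adjugate_gradPhi_le hDt N 0 (B := fun j => M ^ j)
        (fun j => zero_le_one.trans (hMk j)) hDb).trans (ENNReal.ofReal_le_ofReal ?_)
      -- `18 · 3^N Σ_{j ≤ N} (1 + M^j)(1 + M^{N-j}) ≤ 72 (N+1) 3^N M^N`
      have hterm : ∀ j ∈ Finset.range (N + 1), (1 + M ^ j) * (1 + M ^ (N - j)) ≤ 4 * M ^ N := by
        intro j hj
        have hjN : j ≤ N := Nat.lt_succ_iff.1 (Finset.mem_range.1 hj)
        have hpow : M ^ j * M ^ (N - j) = M ^ N := by rw [← pow_add, Nat.add_sub_cancel' hjN]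
        have h1 : 1 + M ^ j ≤ 2 * M ^ j := by linarith [hMk j]
        have h2 : 1 + M ^ (N - j) ≤ 2 * M ^ (N - j) := by linarith [hMk (N - j)]
        calc (1 + M ^ j) * (1 + M ^ (N - j)) ≤ (2 * M ^ j) * (2 * M ^ (N - j)) :=
              mul_le_mul h1 h2 (by positivity) (by positivity)
          _ = 4 * M ^ N := by rw [← hpow]; ring
      have hsum : ∑ j ∈ Finset.range (N + 1), (1 + M ^ j) * (1 + M ^ (N - j)) ≤
          ((N : ℝ) + 1) * (4 * M ^ N) := by
        refine (Finset.sum_le_sum hterm).trans ?_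
        rw [Finset.sum_const, Finset.card_range, nsmul_eq_mul]
        push_cast
        exact le_rfl
      calc 18 * (3 ^ N * ∑ j ∈ Finset.range (N + 1), (1 + M ^ j) * (1 + M ^ (N - j)))
          ≤ 18 * (3 ^ N * (((N : ℝ) + 1) * (4 * M ^ N))) := by gcongr
        _ = 72 * ((N : ℝ) + 1) * 3 ^ N * M ^ N := by ring
  exact ⟨fun t ht => (key t ht).1, fun t ht => (key t ht).2⟩

end Assembly

end BDSV

end Literature.Analysis.FluidPDE
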